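import Summits.QuantumFields.BalabanUV.T4Continuum.Support.SubstrateSlotsOfRecord
import Mathlib.Analysis.Normed.Lp.lpSpace

/-!
# SUBSTRATE — THE `Slots` OF RECORD, FAMILY-SORTED INSERTION LETTERS (`InsLetters.ofFam`; NE5 owner RULING R49 (5)(i) l.16073, typer (η2)(a),
# LIBRARY L-E8 ∕ W-4): on Road D of R48-F the background argument moves into the chart index, so both runs' insertion-operator slots become
# FAMILIES over a chart `𝒰` at the sort `𝒰 × Fin 2 → IOp` — background-blind, constant in the `Fin 2` (Re∕Im row) coordinate

Cell `pub-balaban`, SUBSTRATE cell, seat `b2b-balaban-substrate-p1` (gen 3).  Summits-side under the LEAN PLACEMENT RULE.  A follower module of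
`SubstrateSlotsOfRecord` (p220104 ∕ p222179; kept apart for `lint.size` — that file is at 353 l. — and so that its many consumers are untouched).
HONEST FRAMING: rung (B)+1 of the FINITE-VOLUME T⁴ programme — NOT infinite volume, NOT a mass gap, NOT Clay; spine PROVED 0∕9; NE5 ∕ NE9 NOT
proved.  RE-LETTERING ONLY: `InsLetters` is polymorphic in the insertion-operator sort, so `IOp′ := 𝒰 × Fin 2 → IOp` is admitted verbatim ((η2)(a));
the chart `𝒰` is ABSTRACT here (one instance: `SubstrateChartSection.TwoRunChart D o` with section `sectionOfRecord D ι`, p224186 — not imported,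
cone hygiene); the ℓ^∞ currency and every bound on the families are CONSUMER-side (R49 (3)); nothing printed is asserted ([Balaban1988RG2Cluster]
(1.33) KIND only).  HONEST DEPENDENCY (cell line, verbatim): continuum YM on T⁴ ⇐ BetaPertH ∧ nine spine estimates (0/9 proved); BetaPertH ⇐
(D1) ∧ (D4) ∧ CAP+tail; G-an2-4 gates asym, D1 and NE2/3/4.

WHAT.  §1 **`InsLetters.ofFam Lf iopCA iopC`** (family-sorted core letters `Lf` + POINTWISE operator tables on `𝒰` ⇒ slots `u ↦ iopC r u.1 k`),
`iopA_ofFam ∕ iopB_ofFam` (rfl), `ofFam_core`, **`iopB_ofFam_tag ∕ iopA_ofFam_tag`** (constant in the `Fin 2` coordinate), **`iopB_ofFam_bg ∕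
iopA_ofFam_bg`** (background-blind), **`iopB_ofFam_section ∕ iopA_ofFam_section`** (the VALUE tables of p220104 §1 ∕ p222179 §5 are the special case
read along a section of the chart — displayed identity), `lastCouplingOnly_insOpB∕A_ofFam` (D-6′ survives); §2 `SlotLetters.ofFam`,
`insOpB_slotsOfRecord_ofFam_bg` (the step of record's operator slot at these letters is background-blind, every window).
NAMESPACE: the parent's, `…T4Continuum.SubstrateSlotsOfRecord`, so that `InsLetters.ofFam` ∕ `SlotLetters.ofFam` sit next to `InsLetters.ofAt` and
dot-notation (`L.ins.ofFam …`) works for consumers; no name of p220104 ∕ p222179 is redeclared.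
v1.1 (APPEND-ONLY §3; located junction fact F-ne5leaf08g7-1 ∕ R49 (5)(iii)): the ℓ^∞ sort `FamOp 𝒰 IOp := ↥(lp (fun _ : 𝒰 × Fin 2 => IOp) ⊤)`,
`famOfTable` (a pointwise table packaged under its DISPLAYED uniform bound), `norm_famOfTable_le`, **`InsLetters.ofFamLp`** (+ `_apply` ∕ `_bg` ∕ `_section`
views, `norm_iopB∕A_ofFamLp_le`, D-6′) — for the ENDs that carry `[NormedAddCommGroup IOp]` on an infinite chart; adds `import Mathlib.Analysis.Normed.Lp.lpSpace`.
-/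

noncomputable section

open scoped BigOperators
open _root_.MeasureTheory

namespace Summit.QuantumFields.BalabanUV.T4Continuum.SubstrateSlotsOfRecord

open Literature.MathematicalPhysics.QuantumFieldTheory.Balaban1983to89
open Literature.MathematicalPhysics.QuantumFieldTheory.Balaban1983to89.B5Prop11Plancherel (Tor)
open Literature.MathematicalPhysics.QuantumFieldTheory.Balaban1983to89.B5G183RateUnitTower (lev)
open Summit.QuantumFields.BalabanUV.T4Continuum.CovariantBlockAveraging (ContourSystem)
open Summit.QuantumFields.BalabanUV.T4Continuum.B13HistMeasurable (MeasPotFrame B13HistM)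
open Summit.QuantumFields.BalabanUV.T4Continuum.B13StepTermLabels (InnerLabel)
open Summit.QuantumFields.BalabanUV.T4Continuum.B13InnerData (Bnd)
open Summit.QuantumFields.BalabanUV.T4Continuum.SubstrateBackgroundTransporters (unitMod)
open Summit.QuantumFields.BalabanUV.T4Continuum.SubstrateTwoRunsDriven (DrivenRuns)
open Summit.QuantumFields.BalabanUV.T4Continuum.SubstrateRawSpecies (LastCouplingOnly)

variable {G : Type} [GaugeGroup G] (D : DrivenRuns G)

/-! ## §1 Insertion-operator tables as FAMILIES OVER A CHART (`ofFam`; NE5 owner RULING R49 (5)(i) l.16073, typer (η2)(a) ∕ LIBRARY L-E8) -/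

section OfFam

variable {IOp Hist : Type*} [NormedAddCommGroup Hist] [NormedSpace ℂ Hist] {𝒰 : Type*}

/-- [folklore] **THE `ofFam` LETTERS** (Road D of R48-F ∕ R49: the background argument moves into the chart index): for FAMILY-sorted letters
`Lf : InsLetters D (𝒰 × Fin 2 → IOp) Hist` (core `base ∕ slice ∕ ω` displayed at that sort) and POINTWISE operator tables `iopCA ∕ iopC` on a chart
`𝒰` (e.g. `SubstrateChartSection.TwoRunChart D o`, run A reading its first factor), both runs' insertion-operator slots become the families
`u ↦ iopC r u.1 k` — BACKGROUND-BLIND (the real background no longer enters the slot) and CONSTANT IN THE `Fin 2` (Re∕Im row) COORDINATE, as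
R49 (5)(i) asks; the value tables of §1∕§5 are the special case read along a section (`iopB_ofFam_section`). -/
def InsLetters.ofFam (Lf : InsLetters D (𝒰 × Fin 2 → IOp) Hist) (iopCA iopC : ℝ → 𝒰 → ℕ → IOp) : InsLetters D (𝒰 × Fin 2 → IOp) Hist :=
  { Lf with iopA := fun r _ k => fun u => iopCA r u.1 k, iopB := fun r _ k => fun u => iopC r u.1 k }

variable (Lf : InsLetters D (𝒰 × Fin 2 → IOp) Hist) (iopCA iopC : ℝ → 𝒰 → ℕ → IOp)

/-- [folklore] `rfl` view: run A's family slot. -/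
theorem iopA_ofFam (r : ℝ) (U : D.carriers.BgB) (k : ℕ) : (InsLetters.ofFam D Lf iopCA iopC).iopA r U k = fun u => iopCA r u.1 k := rfl

/-- [folklore] `rfl` view: run B's family slot. -/
theorem iopB_ofFam (r : ℝ) (U : D.carriers.BgB) (k : ℕ) : (InsLetters.ofFam D Lf iopCA iopC).iopB r U k = fun u => iopC r u.1 k := rfl

/-- [folklore] The core letters are unchanged (`rfl` ×3). -/
theorem ofFam_core : (InsLetters.ofFam D Lf iopCA iopC).base = Lf.base ∧ (InsLetters.ofFam D Lf iopCA iopC).slice = Lf.slice ∧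
    (InsLetters.ofFam D Lf iopCA iopC).ω = Lf.ω := ⟨rfl, rfl, rfl⟩

/-- [folklore] **CONSTANT IN THE `Fin 2` COORDINATE** (both rows read the same operator). -/
theorem iopB_ofFam_tag (r : ℝ) (U : D.carriers.BgB) (k : ℕ) (u : 𝒰) (i j : Fin 2) :
    (InsLetters.ofFam D Lf iopCA iopC).iopB r U k (u, i) = (InsLetters.ofFam D Lf iopCA iopC).iopB r U k (u, j) := rfl

/-- [folklore] The same for run A. -/
theorem iopA_ofFam_tag (r : ℝ) (U : D.carriers.BgB) (k : ℕ) (u : 𝒰) (i j : Fin 2) :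
    (InsLetters.ofFam D Lf iopCA iopC).iopA r U k (u, i) = (InsLetters.ofFam D Lf iopCA iopC).iopA r U k (u, j) := rfl

/-- [folklore] **BACKGROUND-BLIND**: the family slot does not read the real background argument. -/
theorem iopB_ofFam_bg (r : ℝ) (U U' : D.carriers.BgB) (k : ℕ) :
    (InsLetters.ofFam D Lf iopCA iopC).iopB r U k = (InsLetters.ofFam D Lf iopCA iopC).iopB r U' k := rfl

/-- [folklore] The same for run A. -/
theorem iopA_ofFam_bg (r : ℝ) (U U' : D.carriers.BgB) (k : ℕ) :
    (InsLetters.ofFam D Lf iopCA iopC).iopA r U k = (InsLetters.ofFam D Lf iopCA iopC).iopA r U' k := rfl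

/-- [folklore] **THE VALUE TABLE IS THE SPECIAL CASE ALONG A SECTION**: if the pointwise table restricts to a value table `iop₀` along a section
`sec : D.carriers.BgB → 𝒰` of the chart (DISPLAYED identity — e.g. at `SubstrateChartSection.sectionOfRecord`), the family slot evaluated at the
section point `(sec U, i)` returns `iop₀ r U k` — run B. -/
theorem iopB_ofFam_section (sec : D.carriers.BgB → 𝒰) (iop₀ : ℝ → D.carriers.BgB → ℕ → IOp) (h : ∀ r U k, iopC r (sec U) k = iop₀ r U k)
    (r : ℝ) (U : D.carriers.BgB) (k : ℕ) (i : Fin 2) : (InsLetters.ofFam D Lf iopCA iopC).iopB r U k (sec U, i) = iop₀ r U k :=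
  h r U k

/-- [folklore] … run A (the value table of §5's `ofAt` kind: `iopAt` read at the transported background). -/
theorem iopA_ofFam_section (sec : D.carriers.BgB → 𝒰) (iopAt : ℝ → D.carriers.BgA → ℕ → IOp)
    (h : ∀ r U k, iopCA r (sec U) k = iopAt r (D.carriers.transport U) k) (r : ℝ) (U : D.carriers.BgB) (k : ℕ) (i : Fin 2) :
    (InsLetters.ofFam D Lf iopCA iopC).iopA r U k (sec U, i) = iopAt r (D.carriers.transport U) k :=
  h r U k

/-- [folklore] D-6′ survives the re-lettering, run B (the same `simp` as §1). -/
theorem lastCouplingOnly_insOpB_ofFam : LastCouplingOnly (insDatumOfRecord D (InsLetters.ofFam D Lf iopCA iopC)).insOpB :=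
  lastCouplingOnly_insOpB D _

/-- [folklore] D-6′ survives the re-lettering, run A. -/
theorem lastCouplingOnly_insOpA_ofFam : LastCouplingOnly (insDatumOfRecord D (InsLetters.ofFam D Lf iopCA iopC)).insOpA :=
  lastCouplingOnly_insOpA D _

end OfFam

/-! ## §2 The slot letters and the step of record at the family sort -/

section OfFamSlots

variable {o : Type} [Fintype o] [DecidableEq o] (ι : G →* Matrix o o ℂ) (c : ℂ) (a : ℝ) (s : ℕ → ℂ)
variable {T ι' S Ω 𝒴 : Type} (P : MeasPotFrame D.carriers) {IOp : Type*} {𝒰 : Type*}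
  (𝒵 : D.carriers.Dom → InnerLabel D.carriers.Dom (Bnd D.toTwoRuns) → Type) [∀ Z j, Fintype (𝒵 Z j)] (dom : ∀ Z j, 𝒵 Z j → D.carriers.Dom)
  (Jc : D.carriers.Dom → InnerLabel D.carriers.Dom (Bnd D.toTwoRuns) → Type) [∀ Z j, Fintype (Jc Z j)]
  (V : D.carriers.Dom → InnerLabel D.carriers.Dom (Bnd D.toTwoRuns) → Type) [∀ Z j, NormedAddCommGroup (V Z j)]
  [∀ Z j, InnerProductSpace ℝ (V Z j)] [∀ Z j, MeasurableSpace (V Z j)] [∀ Z j, BorelSpace (V Z j)] [∀ Z j, FiniteDimensional ℝ (V Z j)]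
  (mI : D.carriers.Dom → InnerLabel D.carriers.Dom (Bnd D.toTwoRuns) → Type) [∀ Z j, Fintype (mI Z j)] [∀ Z j, DecidableEq (mI Z j)]
  (L : SlotLetters D (o := o) (T := T) (ι' := ι') (S := S) (Ω := Ω) (𝒴 := 𝒴) P (IOp := 𝒰 × Fin 2 → IOp) 𝒵 dom Jc V mI)

/-- [folklore] The slot letters at the family sort with both insertion-operator tables re-lettered `ofFam`. -/
def SlotLetters.ofFam (iopCA iopC : ℝ → 𝒰 → ℕ → IOp) :
    SlotLetters D (o := o) (T := T) (ι' := ι') (S := S) (Ω := Ω) (𝒴 := 𝒴) P (IOp := 𝒰 × Fin 2 → IOp) 𝒵 dom Jc V mI :=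
  { L with ins := InsLetters.ofFam D L.ins iopCA iopC }

/-- [folklore] **THE INSERTION-OPERATOR SLOT OF THE STEP OF RECORD AT THE `ofFam` LETTERS IS BACKGROUND-BLIND** (NE9 OBJ-NE9-g31-1 «the table slot
of the step of record is background-blind» — now for the operator slot too), every window: `insOpB g U k = insOpB g U′ k`. -/
theorem insOpB_slotsOfRecord_ofFam_bg (iopCA iopC : ℝ → 𝒰 → ℕ → IOp) (g : ℕ → ℝ) (U U' : D.carriers.BgB) (k : ℕ) :
    (slotsOfRecord D ι c a s P 𝒵 dom Jc V mI (SlotLetters.ofFam D P 𝒵 dom Jc V mI L iopCA iopC)).D.insOpB g U k =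
      (slotsOfRecord D ι c a s P 𝒵 dom Jc V mI (SlotLetters.ofFam D P 𝒵 dom Jc V mI L iopCA iopC)).D.insOpB g U' k := rfl

end OfFamSlots

/-! ## §3 (v1.1) The ℓ^∞ family sort for NORM-NEEDING ENDs (located type-level junction fact F-ne5leaf08g7-1, ne5-leaf-08 g7 l.16730; NE5 owner R49 (3) ∕ (5)(iii)
«operator families in ℓ^∞ over 𝒰ℂ with the uniform-boundedness side condition displayed»): on an INFINITE chart the bare sort `𝒰 × Fin 2 → IOp` carries no
norm (`Pi.normedAddCommGroup` wants `Fintype`), so the ENDs with `[NormedAddCommGroup IOp]` (`B13StepEndInsOp.ne5_of_record_insOp`, E8[rec], Arithmetic) meet the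
family letters at the sort `↥(lp (fun _ : 𝒰 × Fin 2 => IOp) ⊤)`; the pointwise tables are packaged as lp-members UNDER THE DISPLAYED UNIFORM BOUND, which
becomes exactly that membership (and the slot's norm bound). The norm-free ENDs (cores road, leaf-08 J1∕J2) keep §1's bare `ofFam`. -/

section OfFamLp

variable {IOp : Type*} [NormedAddCommGroup IOp] {Hist : Type*} [NormedAddCommGroup Hist] [NormedSpace ℂ Hist] {𝒰 : Type*}

/-- [folklore] THE ℓ^∞ FAMILY SORT over the chart rows `𝒰 × Fin 2` (R49 (3)'s currency `Fam (𝒰 × Fin 2) IOp`, Mathlib `lp … ⊤`, sup norm). -/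
abbrev FamOp (𝒰 : Type*) (IOp : Type*) [NormedAddCommGroup IOp] : Type _ := ↥(lp (fun _ : 𝒰 × Fin 2 => IOp) ⊤)

/-- [folklore] **A POINTWISE OPERATOR TABLE PACKAGED AS AN ℓ^∞ FAMILY under the DISPLAYED uniform bound `‖iopC r u k‖ ≤ B r k`** (constant in the `Fin 2`
coordinate) — the bound is the side condition R49 (5)(iii) displays (print: [Balaban1988RG2Cluster] (1.5), uniformity in the background — KIND only,
asserted by nobody); `memℓp_infty`. -/
def famOfTable (iopC : ℝ → 𝒰 → ℕ → IOp) (B : ℝ → ℕ → ℝ) (hB : ∀ r k u, ‖iopC r u k‖ ≤ B r k) (r : ℝ) (k : ℕ) : FamOp 𝒰 IOp :=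
  ⟨fun u => iopC r u.1 k, memℓp_infty ⟨B r k, by rintro _ ⟨u, rfl⟩; exact hB r k u.1⟩⟩

variable (iopC : ℝ → 𝒰 → ℕ → IOp) (B : ℝ → ℕ → ℝ) (hB : ∀ r k u, ‖iopC r u k‖ ≤ B r k)

/-- [folklore] `rfl` view: the packaged family evaluates to the table (constant in the `Fin 2` coordinate). -/
theorem famOfTable_apply (r : ℝ) (k : ℕ) (u : 𝒰 × Fin 2) : (famOfTable iopC B hB r k : 𝒰 × Fin 2 → IOp) u = iopC r u.1 k := rfl

/-- [folklore] **THE SLOT's NORM BOUND**: `‖famOfTable … r k‖ ≤ B r k` (`lp.norm_le_of_forall_le`; `0 ≤ B r k` displayed). -/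
theorem norm_famOfTable_le (r : ℝ) (k : ℕ) (hB0 : 0 ≤ B r k) : ‖famOfTable iopC B hB r k‖ ≤ B r k :=
  lp.norm_le_of_forall_le hB0 fun u => hB r k u.1

variable (iopCA : ℝ → 𝒰 → ℕ → IOp) (BA : ℝ → ℕ → ℝ) (hBA : ∀ r k u, ‖iopCA r u k‖ ≤ BA r k)

/-- [folklore] **THE `ofFamLp` LETTERS**: §1's `ofFam` at the ℓ^∞ SORT — family-sorted core letters `Lf : InsLetters D (FamOp 𝒰 IOp) Hist` + pointwise tables
WITH their displayed uniform bounds ⇒ both runs' insertion-operator slots are the lp-packaged families (background-blind, constant in the row coordinate). -/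
def InsLetters.ofFamLp (Lf : InsLetters D (FamOp 𝒰 IOp) Hist) : InsLetters D (FamOp 𝒰 IOp) Hist :=
  { Lf with iopA := fun r _ k => famOfTable iopCA BA hBA r k, iopB := fun r _ k => famOfTable iopC B hB r k }

variable (Lf : InsLetters D (FamOp 𝒰 IOp) Hist)

/-- [folklore] `rfl` view, run B, as a function on the chart rows. -/
theorem iopB_ofFamLp_apply (r : ℝ) (U : D.carriers.BgB) (k : ℕ) (u : 𝒰 × Fin 2) :
    ((InsLetters.ofFamLp D iopC B hB iopCA BA hBA Lf).iopB r U k : 𝒰 × Fin 2 → IOp) u = iopC r u.1 k := rfl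

/-- [folklore] `rfl` view, run A. -/
theorem iopA_ofFamLp_apply (r : ℝ) (U : D.carriers.BgB) (k : ℕ) (u : 𝒰 × Fin 2) :
    ((InsLetters.ofFamLp D iopC B hB iopCA BA hBA Lf).iopA r U k : 𝒰 × Fin 2 → IOp) u = iopCA r u.1 k := rfl

/-- [folklore] BACKGROUND-BLIND at the lp sort too. -/
theorem iopB_ofFamLp_bg (r : ℝ) (U U' : D.carriers.BgB) (k : ℕ) :
    (InsLetters.ofFamLp D iopC B hB iopCA BA hBA Lf).iopB r U k = (InsLetters.ofFamLp D iopC B hB iopCA BA hBA Lf).iopB r U' k := rfl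

/-- [folklore] **THE OPERATOR-BOX LETTER**: the run-B slot has norm `≤ B r k` (what an END's op-norm binder reads; sup over the chart = print's uniformity). -/
theorem norm_iopB_ofFamLp_le (r : ℝ) (U : D.carriers.BgB) (k : ℕ) (hB0 : 0 ≤ B r k) :
    ‖(InsLetters.ofFamLp D iopC B hB iopCA BA hBA Lf).iopB r U k‖ ≤ B r k :=
  norm_famOfTable_le iopC B hB r k hB0

/-- [folklore] … run A, `≤ BA r k`. -/
theorem norm_iopA_ofFamLp_le (r : ℝ) (U : D.carriers.BgB) (k : ℕ) (hB0 : 0 ≤ BA r k) :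
    ‖(InsLetters.ofFamLp D iopC B hB iopCA BA hBA Lf).iopA r U k‖ ≤ BA r k :=
  norm_famOfTable_le iopCA BA hBA r k hB0

/-- [folklore] The value table along a section (displayed identity), run B, at the lp sort. -/
theorem iopB_ofFamLp_section (sec : D.carriers.BgB → 𝒰) (iop₀ : ℝ → D.carriers.BgB → ℕ → IOp) (h : ∀ r U k, iopC r (sec U) k = iop₀ r U k)
    (r : ℝ) (U : D.carriers.BgB) (k : ℕ) (i : Fin 2) :
    ((InsLetters.ofFamLp D iopC B hB iopCA BA hBA Lf).iopB r U k : 𝒰 × Fin 2 → IOp) (sec U, i) = iop₀ r U k :=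
  h r U k

/-- [folklore] D-6′ survives at the lp sort, run B. -/
theorem lastCouplingOnly_insOpB_ofFamLp : LastCouplingOnly (insDatumOfRecord D (InsLetters.ofFamLp D iopC B hB iopCA BA hBA Lf)).insOpB :=
  lastCouplingOnly_insOpB D _

/-- [folklore] D-6′ survives at the lp sort, run A. -/
theorem lastCouplingOnly_insOpA_ofFamLp : LastCouplingOnly (insDatumOfRecord D (InsLetters.ofFamLp D iopC B hB iopCA BA hBA Lf)).insOpA :=
  lastCouplingOnly_insOpA D _

end OfFamLp

end Summit.QuantumFields.BalabanUV.T4Continuum.SubstrateSlotsOfRecord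

end
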